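import Summits.NavierStokesRegularity.NavierStokesRegularity.Theorems.AdaptedKernelExists.Negative.GalileanTightness

/-!
# `AdaptedKernelExists` (stmt-NavierStokesRegularity-2956): the Galilean drift unit-tests the a-priori stubs of line `nash-entropy-last-block`

Support / calibration lemmas for the crux `AdaptedFrequency.AdaptedKernelExists`, extracted from
the crux work file `Cruxes/AdaptedKernelExists/Disproof.lean` (cdisprove seat, cycle 2, §5
TARGETS). No conclusion asserts a route item.

The five registered stubs of the picked line (`Cruxes/AdaptedKernelExists/Lines/nash-entropy-last-block.lean`,
gen 3) were attacked; none is false. Proved here, on the Galilean calibration kernel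
(`GalileanCalibration`, `GalileanTightness`):
* `gal_aprioriStub_hypotheses` — the hypotheses of `stub_expMoment` / `stub_upperOfMoments` /
  `stub_lowerOfUpper` (jointly smooth divergence-free drift with the rate `C/√(T - t)`, adapted
  kernel on `Ico t₀ T`, SOME Gaussian envelope on `Ioo t₀ T`, the exponential moment law incl.
  integrability) are JOINTLY satisfied by the NON-ZERO drift `u = C e/√(T - t)` for every `C ≥ 0`
  and unit `e` — each stub is unit-tested beyond `b ≡ 0` — and the conclusion of `stub_expMoment`
  holds there (sharply: `gal_expMoment_sharp`);
* `gal_upper_consts` — any `(C₁, C₂)` that `stub_upperOfMoments` outputs for the constant `C` must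
  have `4ν < C₂` and `(4πν)^{-3/2} e^{4C²‖e‖²/C₂} ≤ C₁` (one time slice; test at the moving pole);
* `gal_lower_consts` — any `(c₁, c₂)` that `stub_lowerOfUpper` outputs must have `c₂ < 4ν` and
  `c₁ ≤ (4πν)^{-3/2} e^{-C²‖e‖²/ν}`.
The line's `C₂ = 48ν`, `C₁ = 7(2πν)^{-3/2}e^{c(C²/ν + C/√ν)}`, `c₂ = 2ν/3` pass all four. [folklore]
-/

noncomputable section

namespace Summit.NavierStokesRegularity.NavierStokesRegularity.Theorems.AdaptedKernelExistsNegative.GalileanStubs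

open Set Filter Topology MeasureTheory Function
open scoped Laplacian InnerProductSpace RealInnerProductSpace ContDiff
open Literature.Analysis.FluidPDE Literature.Analysis

local notation "ℝ³" => EuclideanSpace ℝ (Fin 3)

open UniformDrift Galilean GalileanTight

section Targets

variable {ν T C : ℝ} {x₀ e : ℝ³}

/-- Pointwise form of the exponentially tilted Galilean kernel (completing the square): with
`σ = ν(T - t)`, `c = x₀ - 2C√(T - t) e`,
`e^{⟪α, x - x₀⟫} Γ(t, x) = e^{⟪α, c - x₀⟫ + σ‖α‖²} G_σ(x - (c + 2σα))`. [folklore] -/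
theorem gal_expWeight_eq (hν : 0 < ν) {t : ℝ} (ht : t < T) (α x : ℝ³) :
    Real.exp ⟪α, x - x₀⟫ * galKernel ν T x₀ e C t x =
      Real.exp (⟪α, (x₀ - galDisp C T t • e) - x₀⟫ + ν * (T - t) * ‖α‖ ^ 2) *
        UnboundedOperators.heatKernel (ν * (T - t))
          (x - ((x₀ - galDisp C T t • e) + (2 * (ν * (T - t))) • α)) := by
  have hs : 0 < T - t := sub_pos.2 ht
  set σ : ℝ := ν * (T - t) with hσdef
  have hσ : 0 < σ := mul_pos hν hs
  set c : ℝ³ := x₀ - galDisp C T t • e with hc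
  set K : ℝ := (4 * Real.pi * σ) ^ (-(Module.finrank ℝ ℝ³ : ℝ) / 2) with hK
  have key : ∀ z : ℝ³, ⟪α, z + (c - x₀)⟫ + -(‖z‖ ^ 2) / (4 * σ) =
      (⟪α, c - x₀⟫ + σ * ‖α‖ ^ 2) + -(‖z - (2 * σ) • α‖ ^ 2) / (4 * σ) := by
    intro z
    rw [norm_sub_sq_real, inner_add_right, inner_smul_right, norm_smul, mul_pow, Real.norm_eq_abs,
      sq_abs, real_inner_comm α z]
    field_simp
    ring
  have hG : galKernel ν T x₀ e C t x = UnboundedOperators.heatKernel σ (x - c) := rfl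
  rw [hG]
  simp only [UnboundedOperators.heatKernel]
  rw [← hK, show x - x₀ = (x - c) + (c - x₀) by abel,
    show x - (c + (2 * σ) • α) = (x - c) - (2 * σ) • α by abel]
  calc Real.exp ⟪α, x - c + (c - x₀)⟫ * (K * Real.exp (-‖x - c‖ ^ 2 / (4 * σ)))
      = K * Real.exp (⟪α, x - c + (c - x₀)⟫ + -(‖x - c‖ ^ 2) / (4 * σ)) := by
        rw [Real.exp_add, neg_div]; ring
    _ = K * Real.exp ((⟪α, c - x₀⟫ + σ * ‖α‖ ^ 2) + -(‖x - c - (2 * σ) • α‖ ^ 2) / (4 * σ)) := by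
        rw [key]
    _ = Real.exp (⟪α, c - x₀⟫ + σ * ‖α‖ ^ 2) *
        (K * Real.exp (-‖x - c - (2 * σ) • α‖ ^ 2 / (4 * σ))) := by
        rw [Real.exp_add, neg_div]; ring

/-- The exponentially tilted Galilean kernel is integrable at every `t < T` (it is a constant
multiple of a translated heat kernel). [folklore] -/
theorem gal_expWeight_integrable (hν : 0 < ν) {t : ℝ} (ht : t < T) (α : ℝ³) :
    Integrable (fun x => Real.exp ⟪α, x - x₀⟫ * galKernel ν T x₀ e C t x) := by
  have hσ : 0 < ν * (T - t) := mul_pos hν (sub_pos.2 ht)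
  have hfun : (fun x => Real.exp ⟪α, x - x₀⟫ * galKernel ν T x₀ e C t x) = fun x =>
      Real.exp (⟪α, (x₀ - galDisp C T t • e) - x₀⟫ + ν * (T - t) * ‖α‖ ^ 2) *
        UnboundedOperators.heatKernel (ν * (T - t))
          (x - ((x₀ - galDisp C T t • e) + (2 * (ν * (T - t))) • α)) :=
    funext fun x => gal_expWeight_eq hν ht α x
  rw [hfun]
  exact ((UnboundedOperators.integrable_heatKernel_holds (E := ℝ³) hσ).comp_sub_right _).const_mul _

/-- **The three a-priori stubs are unit-tested by a NON-ZERO drift.** For `ν > 0`, every `C ≥ 0`,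
a unit vector `e`, every window `[t₀, T)` and pole `x₀`: the Galilean drift `u = C e/√(T - t)` and
its kernel `galKernel` satisfy ALL hypotheses of `stub_expMoment` / `stub_upperOfMoments` /
`stub_lowerOfUpper` of the picked line (gen 3): jointly smooth, divergence-free, the rate with
the SAME constant `C`, adapted on `Ico t₀ T`, a Gaussian envelope on `Ioo t₀ T`
(`K = (4πν)^{-3/2}e^{C²/ν}`, `a = 8ν`), and the exponential moment law (integrability + bound) —
the last being the CONCLUSION of `stub_expMoment`, which therefore holds on this instance (and is
attained along `e = -α/‖α‖`, `gal_expMoment_sharp`). No kill; hypotheses jointly satisfiable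
beyond `b ≡ 0`. [folklore] -/
theorem gal_aprioriStub_hypotheses (hν : 0 < ν) (hC : 0 ≤ C) (he : ‖e‖ = 1) (t₀ T : ℝ)
    (x₀ : ℝ³) :
    IsSmoothSpaceTimeOn (Ico t₀ T) (uniformVel (galAmp C T) e) ∧
    (∀ t ∈ Ico t₀ T, VectorCalculus.IsDivFree (uniformVel (galAmp C T) e t)) ∧
    (∀ t ∈ Ico t₀ T, ∀ x, ‖uniformVel (galAmp C T) e t x‖ ≤ C / Real.sqrt (T - t)) ∧
    IsAdaptedBackwardKernel ν (uniformVel (galAmp C T) e) (Ico t₀ T) T x₀ (galKernel ν T x₀ e C) ∧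
    (∃ K a : ℝ, 0 < a ∧ ∀ t ∈ Ioo t₀ T, ∀ x, galKernel ν T x₀ e C t x ≤
        K * (T - t) ^ (-(3 : ℝ) / 2) * Real.exp (-(‖x - x₀‖ ^ 2) / (a * (T - t)))) ∧
    (∀ α : ℝ³, ∀ t ∈ Ioo t₀ T,
        Integrable (fun x => Real.exp ⟪α, x - x₀⟫ * galKernel ν T x₀ e C t x) ∧
        ∫ x, Real.exp ⟪α, x - x₀⟫ * galKernel ν T x₀ e C t x ≤
          Real.exp (ν * ‖α‖ ^ 2 * (T - t) + 2 * C * ‖α‖ * Real.sqrt (T - t))) := by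
  have hcl := isClassicalNSSolutionOn_uniform (uniqueDiffOn_Ico t₀ T)
    ((contDiffOn_galAmp C T).mono Ico_subset_Iio_self) ν e
  refine ⟨hcl.smooth_velocity, hcl.divFree, fun t _ x => ?_,
    (isAdaptedBackwardKernel_gal hν T x₀ e C).mono Ico_subset_Iio_self (uniqueDiffOn_Ico t₀ T),
    ⟨(4 * Real.pi * ν) ^ (-(3 : ℝ) / 2) * Real.exp (C ^ 2 * ‖e‖ ^ 2 / ν), 8 * ν, by positivity,
      fun t ht x => ?_⟩, fun α t ht => ⟨gal_expWeight_integrable hν ht.2 α, ?_⟩⟩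
  · rw [norm_gal, he, mul_one, abs_of_nonneg hC]
  · have h := (gal_two_sided (C := C) (x₀ := x₀) (e := e) hν (show t < T from ht.2) x).2
    rwa [show 8 * ν * (T - t) = (8 * ν) * (T - t) by ring] at h
  · rw [gal_expMoment hν ht.2]
    apply Real.exp_le_exp.2
    have h1 : -⟪α, e⟫ ≤ ‖α‖ := by
      have h2 := abs_real_inner_le_norm α e
      rw [he, mul_one] at h2
      linarith [neg_abs_le ⟪α, e⟫]
    have h3 : 0 ≤ 2 * C * Real.sqrt (T - t) := by positivity
    nlinarith [mul_le_mul_of_nonneg_left h1 h3]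

/-- **Constraints on the output of `stub_upperOfMoments`** (one time slice suffices). If the
Galilean kernel (`C ≠ 0`, `e ≠ 0`) obeys `Γ(t₀, x) ≤ C₁ (T - t₀)^{-3/2} e^{-‖x - x₀‖²/(C₂(T - t₀))}`
for all `x` at ONE time `t₀ < T`, then the width EXCEEDS the free one, `4ν < C₂`, and the
amplitude pays the displacement: `(4πν)^{-3/2} e^{4C²‖e‖²/C₂} ≤ C₁` (test at the moving pole
`x = x₀ - 2C√(T - t₀) e`, where `Γ` equals the free on-diagonal value). Any `(C₁, C₂)` the stub
outputs for the constant `C` must satisfy both (the line's `C₂ = 48ν`,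
`C₁ = 7(2πν)^{-3/2}e^{c(C²/ν + C/√ν)}` do). [folklore] -/
theorem gal_upper_consts (hν : 0 < ν) (hC : C ≠ 0) (he : e ≠ 0) {t₀ : ℝ} (ht₀ : t₀ < T)
    {C₁ C₂ : ℝ} (hC₂ : 0 < C₂)
    (h : ∀ x, galKernel ν T x₀ e C t₀ x ≤
      C₁ * (T - t₀) ^ (-(3 : ℝ) / 2) * Real.exp (-(‖x - x₀‖ ^ 2) / (C₂ * (T - t₀)))) :
    4 * ν < C₂ ∧ (4 * Real.pi * ν) ^ (-(3 : ℝ) / 2) * Real.exp (4 * C ^ 2 * ‖e‖ ^ 2 / C₂) ≤ C₁ := by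
  have hs : 0 < T - t₀ := sub_pos.2 ht₀
  set s := T - t₀ with hsdef
  have hspow : 0 < s ^ (-(3 : ℝ) / 2) := Real.rpow_pos_of_pos hs _
  -- `C₁ > 0` (the kernel is positive)
  have hC₁ : 0 < C₁ := by
    have h1 := h x₀
    have hpos : 0 < galKernel ν T x₀ e C t₀ x₀ :=
      (isAdaptedBackwardKernel_gal hν T x₀ e C).pos t₀ ht₀ x₀
    have h2 : 0 < C₁ * s ^ (-(3 : ℝ) / 2) * Real.exp (-(‖x₀ - x₀‖ ^ 2) / (C₂ * s)) :=
      hpos.trans_le h1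
    have h3 : 0 < s ^ (-(3 : ℝ) / 2) * Real.exp (-(‖x₀ - x₀‖ ^ 2) / (C₂ * s)) := by positivity
    by_contra hle
    push Not at hle
    have : C₁ * s ^ (-(3 : ℝ) / 2) * Real.exp (-(‖x₀ - x₀‖ ^ 2) / (C₂ * s)) ≤ 0 := by
      rw [mul_assoc]
      exact mul_nonpos_of_nonpos_of_nonneg hle h3.le
    linarith
  constructor
  · -- the width must exceed `4ν`
    by_contra hle
    push Not at hle
    refine gal_not_upper_freeVariance (x₀ := x₀) hν hC he ht₀ ⟨C₁, fun x => (h x).trans ?_⟩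
    have hexp : -(‖x - x₀‖ ^ 2) / (C₂ * s) ≤ -(‖x - x₀‖ ^ 2) / (4 * ν * s) := by
      rw [neg_div, neg_div, neg_le_neg_iff]
      exact div_le_div_of_nonneg_left (sq_nonneg _) (by positivity) (by nlinarith)
    exact mul_le_mul_of_nonneg_left (Real.exp_le_exp.2 hexp) (by positivity)
  · -- test at the moving pole
    set d := galDisp C T t₀ with hd
    have h1 := h (x₀ - d • e)
    rw [galKernel, recentredKernel_closed_form hν.le x₀ e _ ht₀] at h1
    have hn1 : ‖x₀ - d • e - x₀ + galDisp C T t₀ • e‖ ^ 2 = 0 := by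
      rw [← hd, show x₀ - d • e - x₀ + d • e = 0 by abel, norm_zero]
      ring
    have hn2 : ‖x₀ - d • e - x₀‖ ^ 2 = 4 * C ^ 2 * s * ‖e‖ ^ 2 := by
      rw [show x₀ - d • e - x₀ = (-d) • e by module, norm_smul, mul_pow, Real.norm_eq_abs, sq_abs,
        hd, galDisp, neg_sq, mul_pow, mul_pow, Real.sq_sqrt hs.le]
      ring
    rw [hn1, hn2, neg_zero, zero_div, Real.exp_zero, mul_one] at h1
    have he1 : -(4 * C ^ 2 * s * ‖e‖ ^ 2) / (C₂ * s) = -(4 * C ^ 2 * ‖e‖ ^ 2 / C₂) := by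
      field_simp
    rw [he1] at h1
    -- h1 : A * s^{-3/2} ≤ C₁ * s^{-3/2} * exp(-k)
    have h2 : (4 * Real.pi * ν) ^ (-(3 : ℝ) / 2) ≤ C₁ * Real.exp (-(4 * C ^ 2 * ‖e‖ ^ 2 / C₂)) := by
      have h3 : (4 * Real.pi * ν) ^ (-(3 : ℝ) / 2) * s ^ (-(3 : ℝ) / 2) ≤
          (C₁ * Real.exp (-(4 * C ^ 2 * ‖e‖ ^ 2 / C₂))) * s ^ (-(3 : ℝ) / 2) := by
        calc _ ≤ _ := h1
          _ = _ := by ring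
      exact le_of_mul_le_mul_right h3 hspow
    have h4 := mul_le_mul_of_nonneg_right h2 (Real.exp_pos (4 * C ^ 2 * ‖e‖ ^ 2 / C₂)).le
    rw [mul_assoc C₁, ← Real.exp_add, neg_add_cancel, Real.exp_zero, mul_one] at h4
    exact h4

/-- **Constraints on the output of `stub_lowerOfUpper`** (one time slice suffices). If
`c₁ (T - t₀)^{-3/2} e^{-‖x - x₀‖²/(c₂(T - t₀))} ≤ Γ(t₀, x)` for all `x` at ONE time `t₀ < T`
(`c₁ > 0`, Galilean kernel with `C ≠ 0`, `e ≠ 0`), then the width is STRICTLY BELOW the free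
one, `c₂ < 4ν`, and the amplitude pays the displacement at the pole:
`c₁ ≤ (4πν)^{-3/2} e^{-C²‖e‖²/ν}`. Any `(c₁, c₂)` the stub outputs for the constant `C` must
satisfy both (the line's `c₂ = 2ν/3` does; its `c₁(ν, C, C₁, C₂)` must carry `e^{-C²/ν}`).
[folklore] -/
theorem gal_lower_consts (hν : 0 < ν) (hC : C ≠ 0) (he : e ≠ 0) {t₀ : ℝ} (ht₀ : t₀ < T)
    {c₁ c₂ : ℝ} (hc₁ : 0 < c₁)
    (h : ∀ x, c₁ * (T - t₀) ^ (-(3 : ℝ) / 2) * Real.exp (-(‖x - x₀‖ ^ 2) / (c₂ * (T - t₀))) ≤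
      galKernel ν T x₀ e C t₀ x) :
    c₂ < 4 * ν ∧ c₁ ≤ (4 * Real.pi * ν) ^ (-(3 : ℝ) / 2) * Real.exp (-(C ^ 2 * ‖e‖ ^ 2 / ν)) := by
  have hs : 0 < T - t₀ := sub_pos.2 ht₀
  set s := T - t₀ with hsdef
  have hspow : 0 < s ^ (-(3 : ℝ) / 2) := Real.rpow_pos_of_pos hs _
  constructor
  · -- the width must be below `4ν`
    by_contra hle
    push Not at hle
    refine gal_not_lower_freeVariance (x₀ := x₀) hν hC he ht₀ ⟨c₁, hc₁, fun x => le_trans ?_ (h x)⟩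
    have hexp : -(‖x - x₀‖ ^ 2) / (4 * ν * s) ≤ -(‖x - x₀‖ ^ 2) / (c₂ * s) := by
      rw [neg_div, neg_div, neg_le_neg_iff]
      exact div_le_div_of_nonneg_left (sq_nonneg _) (by positivity) (by nlinarith)
    exact mul_le_mul_of_nonneg_left (Real.exp_le_exp.2 hexp) (by positivity)
  · -- test at the pole
    have h1 := h x₀
    rw [galKernel_pole hν ht₀] at h1
    simp only [sub_self, norm_zero, ne_eq, OfNat.ofNat_ne_zero, not_false_eq_true, zero_pow,
      neg_zero, zero_div, Real.exp_zero, mul_one] at h1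
    have h2 : c₁ * s ^ (-(3 : ℝ) / 2) ≤
        ((4 * Real.pi * ν) ^ (-(3 : ℝ) / 2) * Real.exp (-(C ^ 2 * ‖e‖ ^ 2 / ν))) *
          s ^ (-(3 : ℝ) / 2) := by
      calc _ ≤ _ := h1
        _ = _ := by ring
    exact le_of_mul_le_mul_right h2 hspow

end Targets

end Summit.NavierStokesRegularity.NavierStokesRegularity.Theorems.AdaptedKernelExistsNegative.GalileanStubs

end
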